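import Literature.NumberTheory.NumberFields.NonGaloisQuarticCMFieldRoots
import HarnessLib

/-!
# A non-Galois quartic CM field: `K = ℚ[X]/(X⁴ + 6X² + 7)`

Topic `Literature/NumberTheory/NumberFields`.  Fully proved (Mathlib only; no named facts, no data): the
number field `K = ℚ[X]/(X⁴ + 6X² + 7) ≅ ℚ(√(−(3+√2)))` is

* of degree `4` over `ℚ` (`finrank_KD`) and totally complex (`isTotallyComplex_KD`);
* a CM field (`isCMField_KD` : Mathlib `NumberField.IsCMField K`): its subfield `ℚ(s)`, `s = −(a²+3)`,
  `s² = 2`, is totally real of degree `2` (`isTotallyReal_E2`, `finrank_E2`) and `[K : ℚ(s)] = 2`, so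
  `IsCMField.ofCMExtension` applies;
* NOT normal over `ℚ` (`not_normal_KD`): if it were, the complex roots of `X⁴ + 6X² + 7` would all lie
  in the image `ℚ(α)` of the embedding `a ↦ α = i√(3+√2)` (`Polynomial.Splits.image_rootSet`), but the
  root `β = i√(3−√2)` does not (`be_not_mem_adjoin_al` of the companion module: `αβ = −√7 ∉ ℚ(√2)`);
* with automorphism group of order `2` (`natCard_algEquiv_KD`): `|Aut_ℚ(K)|` divides `[K:ℚ] = 4`
  (`natCard_algEquiv_dvd_finrank`, via the fixed field of `Aut`), is `≠ 4` (not Galois) and `≠ 1`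
  (complex conjugation `NumberField.IsCMField.complexConj` is a non-trivial automorphism).

So `K` falls under case 3 of the trichotomy for quartic CM fields — (1) Galois with group `C₂ × C₂`
(biquadratic, CM types induced from imaginary quadratic subfields), (2) cyclic Galois, (3) non-Galois with
normal closure dihedral of order `8` — of Shimura, *Abelian Varieties with Complex Multiplication and
Modular Functions* (1998), §8 Example 8.4 (2), in the form of Streng, *Complex multiplication of abelian
surfaces* (2010), Lemma I.3.4 (p. 21); by loc. cit. Example I.7.5 (p. 32; Shimura, §8 Example 8.4 (2)(C)) every
CM type of such a `K` is primitive and its reflex field is another quartic CM field, not isomorphic to `K`.  The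
trichotomy itself, the Galois closure `ℚ(α, √7)` and the reflex field are NOT formalised here; this module only
certifies that the example is CM, quartic, not normal, with `|Aut_ℚ(K)| = 2`.

Design: `KD` is a `def` (a type synonym of `AdjoinRoot quartic`), so that the only `ℚ`-algebra structure on
it is the canonical `algebraRat` of a characteristic-zero field (as for every number field in Mathlib) and
no `AdjoinRoot.instAlgebra` diamond arises; the `Field`/`NumberField` structures are transported with
`inferInstanceAs`.  Embeddings `K → ℂ` are built with `AdjoinRoot.lift`.

## References

* [Shimura1998] G. Shimura, *Abelian Varieties with Complex Multiplication and Modular Functions*,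
  Princeton Univ. Press 1998, §8, Example 8.4 (2). [folklore]
* [Streng2010] M. Streng, *Complex multiplication of abelian surfaces*, PhD thesis, Leiden 2010,
  Lemma I.3.4 (p. 21), Example I.7.5 (p. 32: the reflex field of a non-Galois quartic CM field).
-/

noncomputable section

open Polynomial Complex IntermediateField Module NumberField

namespace Literature.NumberTheory.NumberFields

namespace NonGaloisQuarticCM

/-! ## §1 The number field `K = ℚ[X]/(X⁴ + 6X² + 7)` and its embeddings into `ℂ` -/

/-- Irreducibility of `X⁴ + 6X² + 7` as a `Fact` instance (needed for `Field (AdjoinRoot quartic)`). [folklore] -/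
instance quartic_irreducible_fact : Fact (Irreducible quartic) := ⟨quartic_irreducible⟩

/-- **The field** `K = ℚ[X]/(X⁴ + 6X² + 7) ≅ ℚ(√(−(3+√2)))`.  A `def` (not an `abbrev`), so that the
only `ℚ`-algebra structure Lean finds on it is `algebraRat` (no `AdjoinRoot.instAlgebra` diamond). [folklore] -/
def KD : Type := AdjoinRoot quartic

/-- `K` is a field (`X⁴ + 6X² + 7` is irreducible). [folklore] -/
instance instField : Field KD := inferInstanceAs (Field (AdjoinRoot quartic))
/-- `K` is a number field. [folklore] -/
instance instNumberField : NumberField KD := inferInstanceAs (NumberField (AdjoinRoot quartic))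

/-- the generator `a = X mod (X⁴ + 6X² + 7)` [folklore] -/
def ra : KD := (AdjoinRoot.root quartic : AdjoinRoot quartic)

/-- The generator `a` satisfies `a⁴ + 6a² + 7 = 0`. [folklore] -/
theorem ra_quartic : ra ^ 4 + 6 * ra ^ 2 + 7 = 0 := by
  have h := AdjoinRoot.eval₂_root quartic
  rw [eval₂_quartic] at h
  exact h

/-- the embedding `K → ℂ` sending the generator to a prescribed complex root of the quartic [folklore] -/
def emb (z : ℂ) (hz : z ^ 4 + 6 * z ^ 2 + 7 = 0) : KD →+* ℂ :=
  AdjoinRoot.lift (algebraMap ℚ ℂ) z (by rw [eval₂_quartic]; exact hz)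

/-- `emb z` sends the generator `a` to `z`. [folklore] -/
theorem emb_ra (z : ℂ) (hz : z ^ 4 + 6 * z ^ 2 + 7 = 0) : emb z hz ra = z := AdjoinRoot.lift_root _

/-- `emb z` on the class of a polynomial `f` is `f(z)`. [folklore] -/
theorem emb_mk (z : ℂ) (hz : z ^ 4 + 6 * z ^ 2 + 7 = 0) (f : ℚ[X]) :
    emb z hz (AdjoinRoot.mk quartic f) = aeval z f := by
  have h : AdjoinRoot.lift (algebraMap ℚ ℂ) z (by rw [eval₂_quartic]; exact hz) (AdjoinRoot.mk quartic f)
      = aeval z f := by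
    rw [AdjoinRoot.lift_mk, aeval_def]
  exact h

/-- The image of `emb z` lies in `ℚ(z)`. [folklore] -/
theorem emb_mem_adjoin (z : ℂ) (hz : z ^ 4 + 6 * z ^ 2 + 7 = 0) (x : KD) : emb z hz x ∈ ℚ⟮z⟯ := by
  obtain ⟨f, rfl⟩ := AdjoinRoot.mk_surjective (g := quartic) x
  have h := emb_mk z hz f
  refine h ▸ ?_
  exact algebra_adjoin_le_adjoin ℚ _ (aeval_mem_adjoin_singleton ℚ z)

/-- every embedding sends the generator to a (non-real) root of the quartic [folklore] -/
theorem hom_ra_quartic (φ : KD →+* ℂ) : (φ ra) ^ 4 + 6 * (φ ra) ^ 2 + 7 = 0 := by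
  have h := Polynomial.hom_eval₂ quartic (AdjoinRoot.of quartic) φ (AdjoinRoot.root quartic)
  rw [AdjoinRoot.eval₂_root, map_zero, eval₂_quartic] at h
  exact h.symm

/-- `K` is totally complex: no complex root of `X⁴ + 6X² + 7` is real. [folklore] -/
instance isTotallyComplex_KD : IsTotallyComplex KD where
  isComplex v := by
    rw [InfinitePlace.isComplex_iff, ComplexEmbedding.isReal_iff]
    intro h
    exact conj_ne_of_quartic (hom_ra_quartic v.embedding) (by simpa using RingHom.congr_fun h ra)

/-- the embedding `a ↦ z` as a `ℚ`-algebra hom [folklore] -/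
def embA (z : ℂ) (hz : z ^ 4 + 6 * z ^ 2 + 7 = 0) : KD →ₐ[ℚ] ℂ := (emb z hz).toRatAlgHom

/-- `embA z` and `emb z` agree. [folklore] -/
theorem embA_apply (z : ℂ) (hz : z ^ 4 + 6 * z ^ 2 + 7 = 0) (x : KD) : embA z hz x = emb z hz x := rfl

/-- the image of `a ↦ z` is exactly `ℚ(z)` [folklore] -/
theorem fieldRange_embA (z : ℂ) (hz : z ^ 4 + 6 * z ^ 2 + 7 = 0) : (embA z hz).fieldRange = ℚ⟮z⟯ :=
  le_antisymm (by rintro _ ⟨x, rfl⟩; exact emb_mem_adjoin z hz x)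
    (adjoin_simple_le_iff.mpr ⟨ra, emb_ra z hz⟩)

/-- `K ≅ ℚ(α)` as `ℚ`-algebras [folklore] -/
def equivAdjoinAl : KD ≃ₐ[ℚ] ↥ℚ⟮al⟯ :=
  ((AlgEquiv.ofInjectiveField (embA al al_quartic)).trans
    (Subalgebra.equivOfEq _ _ ((embA al al_quartic).fieldRange_toSubalgebra).symm)).trans
    (IntermediateField.equivOfEq (fieldRange_embA al al_quartic))

/-- `[K : ℚ] = 4` [folklore] -/
theorem finrank_KD : finrank ℚ KD = 4 := by
  rw [equivAdjoinAl.toLinearEquiv.finrank_eq, finrank_al]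

/-! ## §2 The real quadratic subfield `ℚ(s)`, `s² = 2`; `K` is CM -/

/-- `s = −(a² + 3)`, a square root of `2` in `K` [folklore] -/
def rs : KD := -(ra ^ 2) - 3

/-- `s² = 2`. [folklore] -/
theorem rs_sq : rs ^ 2 = 2 := by
  unfold rs; linear_combination ra_quartic

/-- `emb z` sends `s` to `−z² − 3`. [folklore] -/
theorem emb_rs (z : ℂ) (hz : z ^ 4 + 6 * z ^ 2 + 7 = 0) : emb z hz rs = -(z ^ 2) - 3 := by
  have h3 : emb z hz 3 = 3 := map_ofNat _ 3
  simp only [rs, map_sub, map_neg, map_pow, emb_ra, h3]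

/-- `s` is integral over `ℚ` (root of `X² − 2`). [folklore] -/
theorem isIntegral_rs : IsIntegral ℚ rs := by
  refine ⟨X ^ 2 - C 2, monic_X_pow_sub_C _ two_ne_zero, ?_⟩
  simp [rs_sq]

/-- the real quadratic subfield `ℚ(s) ≅ ℚ(√2)` of `K` [folklore] -/
abbrev E2 : IntermediateField ℚ KD := ℚ⟮rs⟯

/-- `[ℚ(s) : ℚ] = 2` [folklore] -/
theorem finrank_E2 : finrank ℚ E2 = 2 := by
  have hle : finrank ℚ E2 ≤ 2 := by
    rw [adjoin.finrank isIntegral_rs]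
    have h := minpoly.degree_le_of_ne_zero ℚ rs (p := X ^ 2 - C 2) (X_pow_sub_C_ne_zero two_pos _)
      (by simp [rs_sq])
    rw [degree_X_pow_sub_C two_pos] at h
    exact natDegree_le_iff_degree_le.mpr h
  have hne : finrank ℚ E2 ≠ 1 := by
    intro h1
    have hbot : E2 = ⊥ := finrank_eq_one_iff.mp h1
    have hmem : rs ∈ (⊥ : IntermediateField ℚ KD) := hbot ▸ mem_adjoin_simple_self ℚ rs
    obtain ⟨q, hq⟩ := mem_bot.mp hmem
    apply rt2_ne_ratCast q
    have h := congrArg (emb al al_quartic) hq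
    rw [emb_rs, al_sq] at h
    simp only [eq_ratCast, map_ratCast] at h
    rw [h]; ring
  have hpos : 0 < finrank ℚ E2 := finrank_pos
  omega

/-- `ℚ(s)` is totally real: every embedding sends `s` to `±√2` [folklore] -/
instance isTotallyReal_E2 : IsTotallyReal E2 where
  isReal w := by
    rw [InfinitePlace.isReal_iff, ComplexEmbedding.isReal_iff]
    set ψ := w.embedding with hψ
    -- the image of the generator is real
    set g : E2 := AdjoinSimple.gen ℚ rs with hg
    have hg2' : g ^ 2 = algebraMap ℚ E2 2 := by
      apply (algebraMap E2 KD).injective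
      rw [map_pow, hg, AdjoinSimple.algebraMap_gen, rs_sq, ← IsScalarTower.algebraMap_apply]
      exact (map_ofNat (algebraMap ℚ KD) 2).symm
    have hg2 : ψ g ^ 2 = 2 := by
      rw [← map_pow, hg2', ← RingHom.comp_apply, map_ofNat]
    have hgreal : (starRingEnd ℂ) (ψ g) = ψ g := by
      have h0 : (ψ g - rt2) * (ψ g + rt2) = 0 := by
        have := rt2_sq; linear_combination hg2 - this
      rcases mul_eq_zero.mp h0 with h | h
      · rw [sub_eq_zero.mp h]; exact rt2_mem_realIF
      · rw [eq_neg_of_add_eq_zero_left h, map_neg]; exact congrArg Neg.neg rt2_mem_realIF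
    ext x
    obtain ⟨f, hf⟩ := (adjoin.powerBasis isIntegral_rs).exists_eq_aeval' x
    rw [adjoin.powerBasis_gen] at hf
    rw [ComplexEmbedding.conjugate_coe_eq, hf, ← hg, aeval_def, hom_eval₂, hom_eval₂, hgreal]
    congr 1
    exact Subsingleton.elim _ _

/-- `[K : ℚ(s)] = 2`. [folklore] -/
instance isQuadraticExtension_E2_KD : Algebra.IsQuadraticExtension E2 KD where
  finrank_eq_two' := by
    have h := Module.finrank_mul_finrank ℚ E2 KD
    rw [finrank_E2, finrank_KD] at h
    omega

/-- `K` is a CM field (totally complex, quadratic over the totally real `ℚ(s)`) [folklore] -/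
instance isCMField_KD : IsCMField KD := IsCMField.ofCMExtension E2 KD

/-! ## §3 `K` is not normal over `ℚ`; `|Aut_ℚ(K)| = 2` -/

/-- The minimal polynomial of the generator `a` is `X⁴ + 6X² + 7`. [folklore] -/
theorem minpoly_ra : minpoly ℚ ra = quartic :=
  (minpoly.eq_of_irreducible_of_monic quartic_irreducible
    (show aeval ra quartic = 0 by rw [aeval_def, eval₂_quartic]; exact ra_quartic) quartic_monic).symm

/-- `β` is a complex root of `X⁴ + 6X² + 7` (root-set form). [folklore] -/
theorem be_mem_rootSet : be ∈ quartic.rootSet ℂ := by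
  rw [mem_rootSet_of_ne quartic_ne_zero, aeval_def, eval₂_quartic]
  exact be_quartic

/-- **`K` is not normal over `ℚ`.**  If it were, `X⁴ + 6X² + 7 = minpoly ℚ a` would split in `K`, so its
complex roots would be the images of its roots in `K` under the embedding `a ↦ α`
(`Polynomial.Splits.image_rootSet`), hence lie in `ℚ(α)`; but `β ∉ ℚ(α)`.  (Shimura 1998, §8 Example 8.4 (2),
case 3; Streng 2010, Lemma I.3.4.) [folklore] -/
theorem not_normal_KD : ¬ Normal ℚ KD := by
  intro hN
  have hs : ((minpoly ℚ ra).map (algebraMap ℚ KD)).Splits := hN.splits ra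
  rw [minpoly_ra] at hs
  have himg : (embA al al_quartic) '' quartic.rootSet KD = quartic.rootSet ℂ := hs.image_rootSet _
  have hbe := be_mem_rootSet
  rw [← himg] at hbe
  obtain ⟨x, -, hx⟩ := hbe
  have hx' : emb al al_quartic x = be := hx
  exact be_not_mem_adjoin_al (hx' ▸ emb_mem_adjoin al al_quartic x)

/-- `K/ℚ` is not Galois. [folklore] -/
theorem not_isGalois_KD : ¬ IsGalois ℚ KD := fun _ => not_normal_KD inferInstance

/-- For a finite extension `E/F` of fields, `|Aut_F(E)|` divides `[E:F]`
(`[E:F] = [E:E^{Aut}]·[E^{Aut}:F]` and `[E:E^{Aut}] = |Aut|`, Artin). [folklore] -/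
theorem natCard_algEquiv_dvd_finrank (F E : Type*) [Field F] [Field E] [Algebra F E]
    [FiniteDimensional F E] : Nat.card (E ≃ₐ[F] E) ∣ finrank F E := by
  have h1 : finrank ↥(IntermediateField.fixedField (⊤ : Subgroup (E ≃ₐ[F] E))) E =
      Nat.card (E ≃ₐ[F] E) := by
    rw [IntermediateField.finrank_fixedField_eq_card, Subgroup.card_top]
  rw [← h1]
  exact Dvd.intro_left _ (Module.finrank_mul_finrank F _ E)

/-- Complex conjugation of the CM field `K`, as a `ℚ`-algebra automorphism. [folklore] -/
def conjKD : KD ≃ₐ[ℚ] KD := (IsCMField.complexConj KD).restrictScalars ℚ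

/-- Complex conjugation of `K` is not the identity. [folklore] -/
theorem conjKD_ne_one : conjKD ≠ 1 := by
  intro h
  apply IsCMField.complexConj_ne_one (K := KD)
  ext x
  have := congrArg (fun σ : KD ≃ₐ[ℚ] KD => σ x) h
  simpa [conjKD] using this

/-- **`|Aut_ℚ(K)| = 2`**: the automorphism group of the non-normal quartic CM field `K` is
`{1, complex conjugation}`. [folklore] -/
theorem natCard_algEquiv_KD : Nat.card (KD ≃ₐ[ℚ] KD) = 2 := by
  have hdvd : Nat.card (KD ≃ₐ[ℚ] KD) ∣ 4 := finrank_KD ▸ natCard_algEquiv_dvd_finrank ℚ KD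
  have hne4 : Nat.card (KD ≃ₐ[ℚ] KD) ≠ 4 := fun h4 =>
    not_isGalois_KD (IsGalois.of_card_aut_eq_finrank (F := ℚ) (E := KD) (h4.trans finrank_KD.symm))
  have hne1 : Nat.card (KD ≃ₐ[ℚ] KD) ≠ 1 := fun h1 => by
    haveI : Finite (KD ≃ₐ[ℚ] KD) := Nat.finite_of_card_ne_zero (by omega)
    have hsub : Subsingleton (KD ≃ₐ[ℚ] KD) := (Nat.card_eq_one_iff_unique.mp h1).1
    exact conjKD_ne_one (Subsingleton.elim _ _)
  have hpos : 0 < Nat.card (KD ≃ₐ[ℚ] KD) := Nat.card_pos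
  obtain ⟨k, hk, hfk⟩ := (Nat.dvd_prime_pow Nat.prime_two).mp (show Nat.card (KD ≃ₐ[ℚ] KD) ∣ 2 ^ 2 from hdvd)
  interval_cases k
  · exact absurd hfk hne1
  · simpa using hfk
  · exact absurd hfk hne4

/-- `Aut_ℚ(K)` is cyclic (of order `2`). [folklore] -/
instance isCyclic_algEquiv_KD : IsCyclic (KD ≃ₐ[ℚ] KD) :=
  isCyclic_of_prime_card (p := 2) natCard_algEquiv_KD

end NonGaloisQuarticCM

end Literature.NumberTheory.NumberFields
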